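import Summits.QuantumFields.QCD.Theorems.WilsonMobilityGapChiralMobilityGapAnchorScope

/-!
# Crux `ChiralMobilityGap` (stmt-QuantumFields-17497) — line `Ideator3Sketch`, GLUE STUB A
# `stub_upperOfPionCeiling`: clause (ii) UPPER on the diagonal from a second-moment (pion) ceiling

At a DEGENERATE bare tuple `(x,…,x)` with `N_f ≥ 2` identical flavours the entry sum
`X = Σ_{a,i,b,j}|G_f(0,v)_{ai,bj}|` of the quark propagator has phase-quenched integrable moments
`X^{1/2}` (`integrable_propSum_rpow`) and `X²` (`|det D|·X² ≤ 144 |det D_W|^{N_f-2} Σ|adj D_W|²`, landed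
`integrable_sum_norm_inv_diracMatrix_sq` plus `(Σ g)² ≤ 144 Σ g²`), so LYAPUNOV under the phase-quenched
PROBABILITY measure `qcdLatticeMeasure` gives `fm(…, 1/2) ≤ fm(…, 2)^{1/4}`
(`fm_half_le_fm_two_rpow_quarter`).  Hence a ceiling `fm(2) ≤ C e^{-δ a_k ‖v‖}` along the realised
diagonal bare trajectory of ANY regularisation yields clause (ii) `Upper reg (t,…,t)` with
`(s, δ', C') = (1/2, δ/4, C^{1/4})` (`stub_upperOfPionCeiling`, the registered glue stub of skeleton v5,
applied by the skeleton to the anchored witness `anchorReg N_f` with the physical stub `stub_pionCeiling`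
as its hypothesis).
-/

noncomputable section

namespace Summit.QuantumFields.QCD.Theorems.ChiralMobilityGapAnchor

open scoped BigOperators Topology
open MeasureTheory Filter Set
open Literature.MathematicalPhysics.QuantumFieldTheory Literature.MathematicalPhysics.QuantumLattice
  Literature.Probability.LatticeModels
open Summit.QuantumFields.QCD.Theorems.MobilityGapNegative (bare fm ClauseI Upper Lower Sign Clauses)
open Summit.QuantumFields.QCD.Theorems.ChiralMobilityGapSketch (LowerWith VanishingChiralRate lower_iff)
open Summit.QuantumFields.QCD.Theorems.MobilityGapSketch (propSum propSum_nonneg measurable_propSum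
  integrable_propSum_rpow fm_eq_expect fm_eq_integral negativeFm_eq_fm)
open Summit.QuantumFields.QCD.Theorems.ChiralMobilityGapSketch (integrable_sum_norm_inv_diracMatrix_sq)

variable {Nf : ℕ}

/-- **The squared entry sum is phase-quenched integrable at a degenerate tuple with `N_f ≥ 2`**:
`X² ≤ 144 Σ|G|²` configuration-wise (`ℓ¹/ℓ²` on the `144` colour–spin entries) and the squared
same-flavour propagator entries are integrable (`integrable_sum_norm_inv_diracMatrix_sq`). -/
theorem integrable_propSum_sq (hNf : 2 ≤ Nf) (S : ℕ) (β x : ℝ) (f : Fin Nf) (v : Site 4) :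
    Integrable (fun U : GaugeConfig 4 (2 * S + 1) SU3 => propSum Nf S (fun _ => x) f v U ^ (2 : ℝ))
      (qcdLatticeMeasure (2 * S + 1) β (fun _ : Fin Nf => x)) := by
  have hP0 := propSum_nonneg Nf S (fun _ : Fin Nf => x) f v
  -- integrability of the pion weight `Σ|G|²`
  have hXi := integrable_sum_norm_inv_diracMatrix_sq (S := 2 * S + 1) hNf β x f
    (Torus.proj (2 * S + 1) 0) (Torus.proj (2 * S + 1) v)
  -- `ℓ¹/ℓ²`: `X² ≤ 144 Σ|G|²` configuration-wise
  have hPX : ∀ U : GaugeConfig 4 (2 * S + 1) SU3, propSum Nf S (fun _ : Fin Nf => x) f v U ^ (2 : ℝ) ≤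
      144 * ∑ a : Fin 3, ∑ i : Fin 4, ∑ b : Fin 3, ∑ j : Fin 4,
        ‖(diracMatrix U (fun _ : Fin Nf => x))⁻¹ (quarkEquiv (f, (Torus.proj (2 * S + 1) 0, a, i)))
          (quarkEquiv (f, (Torus.proj (2 * S + 1) v, b, j)))‖ ^ (2 : ℕ) := fun U => by
    rw [Real.rpow_two]
    exact (MobilityGapPinch.sum_sq_le_sq_sum_le (fun a i b j =>
      ‖(diracMatrix U (fun _ : Fin Nf => x))⁻¹ (quarkEquiv (f, (Torus.proj (2 * S + 1) 0, a, i)))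
        (quarkEquiv (f, (Torus.proj (2 * S + 1) v, b, j)))‖) fun _ _ _ _ => norm_nonneg _).2
  exact Integrable.mono' (hXi.const_mul 144)
    ((measurable_propSum Nf S (fun _ : Fin Nf => x) f v).pow_const _).aestronglyMeasurable
    (Eventually.of_forall fun U => by
      rw [Real.norm_eq_abs, abs_of_nonneg (Real.rpow_nonneg (hP0 U) _)]
      exact hPX U)

/-- **Lyapunov on the diagonal, `N_f ≥ 2`: `fm(…, 1/2) ≤ fm(…, 2)^{1/4}`.**  Both are moments of the entry
sum `X ≥ 0` under the phase-quenched probability measure (`fm_eq_expect`), `X^{1/2}` and `X²` are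
integrable there, and `⟨X^{1/2}⟩₊ ≤ ⟨X²⟩₊^{(1/2)/2}` (`qcdPhaseQuenchedExpect_rpow_le_rpow`). -/
theorem fm_half_le_fm_two_rpow_quarter (hNf : 2 ≤ Nf) (β x : ℝ) (S : ℕ) (f : Fin Nf) (v : Site 4) :
    fm Nf β (fun _ => x) S f v (1 / 2) ≤ fm Nf β (fun _ => x) S f v 2 ^ (1 / 4 : ℝ) := by
  have hZ := integral_norm_det_diracMatrix_pos_all (S := 2 * S + 1) β (fun _ : Fin Nf => x)
  have hP0 := propSum_nonneg Nf S (fun _ : Fin Nf => x) f v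
  have hi' := integrable_propSum_rpow Nf S β (fun _ : Fin Nf => x) f v
    (by norm_num : (0 : ℝ) ≤ 1 / 2) (by norm_num : (1 / 2 : ℝ) ≤ 1)
  have hi := integrable_propSum_sq hNf S β x f v
  have hLyap := qcdPhaseQuenchedExpect_rpow_le_rpow (S := 2 * S + 1) β (fun _ : Fin Nf => x) hZ
    (propSum Nf S (fun _ : Fin Nf => x) f v) hP0 (by norm_num : (0 : ℝ) < 1 / 2)
    (by norm_num : (1 / 2 : ℝ) ≤ 2) hi' hi
  have h4 : (1 / 2 : ℝ) / 2 = 1 / 4 := by norm_num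
  rw [h4] at hLyap
  rw [negativeFm_eq_fm, fm_eq_expect, fm_eq_expect]
  exact hLyap

/-- GLUE STUB A.  **Clause (ii) on the diagonal from a second-moment ceiling.**  For `N_f ≥ 2` identical
flavours the `½`-moment of the entry sum is at most the fourth root of its second moment (Lyapunov under
the phase-quenched PROBABILITY measure `qcdLatticeMeasure`; `X^{1/2}` and `X²` are integrable there —
`integrable_propSum_rpow`, and `|det|^{N_f}X² ≤ 144|det|^{N_f-2}Σ|adj|²` as in `stub_momentCompare`), so a
ceiling `fm(2) ≤ C e^{-δ a_k ‖v‖}` gives `Upper reg (t,…,t)` with `(s, δ', C') = (1/2, δ/4, C^{1/4})`. -/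
theorem stub_upperOfPionCeiling : ∀ {Nf : ℕ}, 2 ≤ Nf → ∀ (reg : QCDRegularisation Nf) (t : ℝ),
    (∃ δ C : ℝ, 0 < δ ∧ ∀ᶠ k in atTop, ∀ S : ℕ, reg.L k ≤ S → ∀ (f : Fin Nf) (v : Site 4), v ∈ box 4 S →
      fm Nf (reg.β k) (bare reg (fun _ => t) k) S f v 2 ≤ C * Real.exp (-(δ * (reg.a k * ‖v‖)))) →
    Upper reg (fun _ => t) := by
  intro Nf hNf reg t h
  obtain ⟨δ, C, hδ, hE⟩ := h
  refine ⟨1 / 2, δ / 4, C ^ (1 / 4 : ℝ), by norm_num, by norm_num, by positivity, ?_⟩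
  filter_upwards [hE] with k hk S hS f v hv
  -- read the ceiling at the constant tuple `x_k = m_crit(k) + a_k t / Z_m(k)`
  have h2 : fm Nf (reg.β k) (fun _ : Fin Nf => reg.mcrit k + reg.a k * t / reg.Zm k) S f v 2 ≤
      C * Real.exp (-(δ * (reg.a k * ‖v‖))) := hk S hS f v hv
  -- `fm ≥ 0`: an integral of the non-negative `X²` against the phase-quenched probability measure
  have hF0 : 0 ≤ fm Nf (reg.β k) (fun _ : Fin Nf => reg.mcrit k + reg.a k * t / reg.Zm k) S f v 2 := by
    rw [negativeFm_eq_fm, fm_eq_integral]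
    exact integral_nonneg fun U => Real.rpow_nonneg (propSum_nonneg Nf S _ f v U) _
  have hC0 : 0 ≤ C := nonneg_of_mul_nonneg_left (hF0.trans h2) (Real.exp_pos _)
  have hmain := fm_half_le_fm_two_rpow_quarter hNf (reg.β k) (reg.mcrit k + reg.a k * t / reg.Zm k) S f v
  refine hmain.trans ?_
  have hexp : -(δ * (reg.a k * ‖v‖)) * (1 / 4 : ℝ) = -(δ / 4 * (reg.a k * ‖v‖)) := by ring
  calc fm Nf (reg.β k) (fun _ : Fin Nf => reg.mcrit k + reg.a k * t / reg.Zm k) S f v 2 ^ (1 / 4 : ℝ)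
      ≤ (C * Real.exp (-(δ * (reg.a k * ‖v‖)))) ^ (1 / 4 : ℝ) := Real.rpow_le_rpow hF0 h2 (by norm_num)
    _ = C ^ (1 / 4 : ℝ) * Real.exp (-(δ / 4 * (reg.a k * ‖v‖))) := by
      rw [Real.mul_rpow hC0 (Real.exp_pos _).le, ← Real.exp_mul, hexp]

end Summit.QuantumFields.QCD.Theorems.ChiralMobilityGapAnchor

end
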